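import Literature.Computability.Cryptography.LWEPsiBarSampler
import Literature.Computability.Cryptography.UniformResidueSampling
import Literature.Probability.Distributions.IndepProductLawDistance
import HarnessLib

/-!
# Self-generated LWE samples with approximate uniform parts and approximate noise: the law, and its distance to `A_{s,χ}` with `s ← U`

Topic `Computability/Cryptography` (LWE), grouping namespace `BLPRS2013`. The selection stage of the h₃ machine (`BLPRSSection4AssemblyExplicit.lean`,
`selectWith … Est`; BLPRS 2013, Thm. 4.1 proof, following Regev 2009, Lemma 4.1: "estimate the acceptance probability using LWE samples it generates
itself") needs the machine to DRAW `A_{s,χ}^m` with `s` uniform and `χ = Ψ̄_Q(α₂)`. The machine draws `s` and the `a`'s as residues of coin words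
(`UniformResidueSampling.modLaw`, `(n·Q/2ᴸ)`-close to uniform) and the noise from its `Ψ̄` sampler (`LWEPsiBarSampler.psiLaw`, close to `Ψ̄_Q(β)`). This file
is the law-level bookkeeping (everything PROVED; three definitions with bodies; no named fact):

* `lweSampleWith P_a χ s` (one sample with `a ← P_a`, `e ← χ`; `= lweSample χ s` at `P_a = U`), `lweSamplesWith`, `lweSelfWith P_s P_a χ m`
  (`s ← P_s`, then `m` samples; `= lweSamplesUniformSecret χ m` at `P_s = P_a = U`);
* `tvDist_lweSampleWith_le` (`≤ Δ(P_a, U) + Δ(χ', χ)`), `tvDist_lweSamplesWith_le` (`≤ m·(…)`), **`tvDist_lweSelfWith_le`**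
  (`≤ Δ(P_s, U) + m·(Δ(P_a, U) + Δ(χ', χ))`), and the residue/Ψ̄-sampler instance **`tvDist_lweSelfWith_machine_le`**.

## References

* O. Regev, *On lattices, learning with errors …*, J. ACM 56 (2009), Lemma 4.1 (proof: self-generated samples; the shift from coins). [RegevLWE2009]
* Z. Brakerski, A. Langlois, C. Peikert, O. Regev, D. Stehlé, *Classical hardness of learning with errors*, STOC 2013; arXiv:1306.0281, Thm. 4.1 (proof) and §5.
  [BrakerskiEtAl2013]
* O. Goldreich, *Foundations of Cryptography I*, CUP 2001, §3.2.1–§3.2.3. [Goldreich2001]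
-/

noncomputable section

open scoped ENNReal
open PMF Literature.Probability.Distributions

namespace Literature.Computability.Cryptography

namespace BLPRS2013

open LWE

/-! ### The laws -/

section Laws

variable {ι : Type} [Fintype ι] [DecidableEq ι] {R : Type} [CommRing R] [Fintype R]

/-- **One LWE sample with an arbitrary law of `a`**: `a ← P_a`, `e ← χ`, output `(a, ⟨a, s⟩ + e)`. [cite: RegevLWE2009, Lemma 4.1 (proof)] -/
def lweSampleWith (Pa : PMF (ι → R)) (χ : PMF R) (s : ι → R) : PMF ((ι → R) × R) :=
  Pa.bind fun a => χ.map fun e => (a, a ⬝ᵥ s + e)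

/-- At the uniform law of `a` this is the tree's `lweSample`. [folklore] -/
theorem lweSampleWith_uniform (χ : PMF R) (s : ι → R) : lweSampleWith (PMF.uniformOfFintype (ι → R)) χ s = lweSample χ s := rfl

/-- `m` independent such samples. [cite: RegevLWE2009, Lemma 4.1 (proof)] -/
def lweSamplesWith (Pa : PMF (ι → R)) (χ : PMF R) (s : ι → R) (m : ℕ) : PMF (Fin m → (ι → R) × R) :=
  iidPMF (lweSampleWith Pa χ s) m

/-- **Self-generated LWE tuples**: `s ← P_s`, then `m` samples with `a ← P_a`, `e ← χ`. [cite: RegevLWE2009, Lemma 4.1 (proof)] -/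
def lweSelfWith (Ps Pa : PMF (ι → R)) (χ : PMF R) (m : ℕ) : PMF (Fin m → (ι → R) × R) :=
  Ps.bind fun s => lweSamplesWith Pa χ s m

/-- At the uniform laws this is the tree's `lweSamplesUniformSecret`. [folklore] -/
theorem lweSelfWith_uniform (χ : PMF R) (m : ℕ) :
    lweSelfWith (PMF.uniformOfFintype (ι → R)) (PMF.uniformOfFintype (ι → R)) χ m = lweSamplesUniformSecret χ m := rfl

/-- **One sample: `Δ ≤ Δ(P_a, U) + Δ(χ', χ)`.** [cite: Goldreich2001, §3.2.1] -/
theorem tvDist_lweSampleWith_le (Pa : PMF (ι → R)) (χ' χ : PMF R) (s : ι → R) :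
    (lweSampleWith Pa χ' s).tvDist (lweSample χ s) ≤ Pa.tvDist (PMF.uniformOfFintype (ι → R)) + χ'.tvDist χ := by
  rw [← lweSampleWith_uniform]
  refine (PMF.tvDist_triangle_holds _ (lweSampleWith (PMF.uniformOfFintype (ι → R)) χ' s) _).trans (add_le_add ?_ ?_)
  · exact tvDist_bind_left_le _ _ _
  · refine PMF.tvDist_bind_le_of_forall_le _ _ _ fun a => ?_
    exact PMF.tvDist_map_le_holds _ _ _

/-- **`m` samples: `Δ ≤ m·(Δ(P_a, U) + Δ(χ', χ))`.** [cite: Goldreich2001, §3.2.3] -/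
theorem tvDist_lweSamplesWith_le (Pa : PMF (ι → R)) (χ' χ : PMF R) (s : ι → R) (m : ℕ) :
    (lweSamplesWith Pa χ' s m).tvDist (lweSamples χ s m) ≤ m * (Pa.tvDist (PMF.uniformOfFintype (ι → R)) + χ'.tvDist χ) := by
  unfold lweSamplesWith lweSamples
  exact (tvDist_iidPMF_le _ _ m).trans (mul_le_mul_of_nonneg_left (tvDist_lweSampleWith_le Pa χ' χ s) (Nat.cast_nonneg m))

/-- **Self-generated tuples: `Δ ≤ Δ(P_s, U) + m·(Δ(P_a, U) + Δ(χ', χ))`.** [cite: RegevLWE2009, Lemma 4.1 (proof); Goldreich2001, §3.2.1, §3.2.3] -/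
theorem tvDist_lweSelfWith_le (Ps Pa : PMF (ι → R)) (χ' χ : PMF R) (m : ℕ) :
    (lweSelfWith Ps Pa χ' m).tvDist (lweSamplesUniformSecret χ m) ≤
      Ps.tvDist (PMF.uniformOfFintype (ι → R)) + m * (Pa.tvDist (PMF.uniformOfFintype (ι → R)) + χ'.tvDist χ) := by
  unfold lweSelfWith lweSamplesUniformSecret
  refine (PMF.tvDist_triangle_holds _ ((PMF.uniformOfFintype (ι → R)).bind fun s => lweSamplesWith Pa χ' s m) _).trans (add_le_add ?_ ?_)
  · exact tvDist_bind_left_le _ _ _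
  · exact PMF.tvDist_bind_le_of_forall_le _ _ _ fun s => tvDist_lweSamplesWith_le Pa χ' χ s m

end Laws

/-! ### The machine's instance: residues and the `Ψ̄` sampler -/

section Machine

variable (Q : ℕ) [NeZero Q] (n : ℕ)

/-- **The machine's self-generated LWE tuples**: secret and `a`'s from `L`-bit residues, noise from `psiLaw`. [cite: BrakerskiEtAl2013, §5; RegevLWE2009, Lemma 4.1 (proof)] -/
def machSelfLWE (L m : ℕ) (κh : ℝ) (b : ℕ) (ℓ : PMF ℤ) : PMF (Fin m → (Fin n → ZMod Q) × ZMod Q) :=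
  lweSelfWith (iidPMF (modLaw (2 ^ L) Q) n) (iidPMF (modLaw (2 ^ L) Q) n) (psiLaw Q κh b ℓ) m

variable {Q n}

/-- **The machine's tuples are close to `A_{s,Ψ̄_Q(β)}^m`, `s ← U`**: `Δ ≤ (m+1)·n·Q/2ᴸ + m·Δ(psiLaw, Ψ̄_Q(β))`.
[cite: RegevLWE2009, Lemma 4.1 (proof); BrakerskiEtAl2013, §5; Goldreich2001, §3.2.3] -/
theorem tvDist_machSelfLWE_le (L m : ℕ) (κh β : ℝ) (b : ℕ) (ℓ : PMF ℤ) :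
    (machSelfLWE Q n L m κh b ℓ).tvDist (lweSamplesUniformSecret (discretizedGaussian Q β) m) ≤
      (m + 1) * (n * ((Q : ℝ) / 2 ^ L)) + m * (psiLaw Q κh b ℓ).tvDist (discretizedGaussian Q β) := by
  have h := tvDist_lweSelfWith_le (iidPMF (modLaw (2 ^ L) Q) n) (iidPMF (modLaw (2 ^ L) Q) n) (psiLaw Q κh b ℓ) (discretizedGaussian Q β) m
  have hres := tvDist_iidPMF_modLaw_le (2 ^ L) Q n
  have hm : (0 : ℝ) ≤ m := Nat.cast_nonneg m
  unfold machSelfLWE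
  refine h.trans ?_
  push_cast at hres ⊢
  nlinarith [hres, mul_le_mul_of_nonneg_left hres hm, PMF.tvDist_nonneg (psiLaw Q κh b ℓ) (discretizedGaussian Q β)]

end Machine

end BLPRS2013

end Literature.Computability.Cryptography

end
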